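import Mathlib
import HarnessLib
import Summits.NavierStokesRegularity.NavierStokesRegularity.Theorems.QuarterLogPincerSmoothSilenceDefs
import Summits.NavierStokesRegularity.NavierStokesRegularity.Theorems.QuarterLogPincerLimitSilenceNormalisation
import Literature.Analysis.FluidPDE.ClassicalSolutionRescale
import Literature.Analysis.FluidPDE.KNSSLocalSmoothingHolds

/-!
# Route `QuarterLogPincer`, crux `TypeIQuantSubcubicExp` (stmt-NavierStokesRegularity-24077), line `smooth_silence` —
# L♯1 `stub_smoothNormalisation : SmoothNormalisation` BY NAME (parabolic rescaling of the drift–stretch class)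

ns-idea-7's line `Cruxes/TypeIQuantSubcubicExp/Lines/smooth_silence.lean` (v1.1, idea-crit-4 RE-STAMP PASS 2026-08-29T07:46Z)
carries the stub L♯1 `stub_smoothNormalisation : SmoothNormalisation := ¬ DriftStretchSilencingCost → SmoothFailingFamily`
(«S–M, Lean calculus; certainly true»): the negation of Sc″, read at `K := Γ₂ + n`, `c := min δ (1/(n+1))`, hands a bad
configuration `(ω, v, y, σ, t, t₁)` of the drift–stretch class; the parabolic rescaling `ω̃ s z := σ² • ω (t + σ² s) (y + σ z)`,
`ṽ s z := σ • v (t + σ² s) (y + σ z)` on `[0, (t₁ − t)/σ²] × ℝ³` is in the class at scale `1` with the SAME `B` and `γ`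
(`σ^{j+2}‖∇ʲω‖ ≤ B`, `σ^{j+1}‖∇ʲv‖ ≤ B`, the time moduli are scale-invariant, and the EQUATION scales by `σ⁴` termwise), has
initial mass `σ·(δ/σ) = δ` on `B(0, Γ₂)` and final mass `< σ·(c/σ) = c ≤ 1/(n+1)` on `B(0, Γ₂ + n)`.  Same method and
dictionary as the tree's L1a `LimitSilence.stub_failingFamily` (p705045: `preimage_affine_Icc`, `setLIntegral_ball_comp_affine`,
`IsSmoothSpaceTimeOn.smul_stPull`, `timeDerivWithin_smul_stPull`, `laplacian_stPull`, `fderiv_stPull`), plus the homothety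
bound for iterated derivatives (`norm_iteratedFDeriv_comp_smul_le`, `iteratedFDeriv_const_smul_real`, `iteratedFDeriv_comp_add_left`)
for the orders `j ≤ 5`.

HONEST FRAME: an implication between two Props about a linear parabolic class (no Navier–Stokes object); it closes one registered
stub of a line four levels below the crux; nothing here bears on Sc″, E2, 24077's truth, W7 or Navier–Stokes regularity (OPEN / not
proved).  pub-ns-dss typer (g38), `--supports stmt-NavierStokesRegularity-24077`.
-/

noncomputable section

set_option linter.dupNamespace false

namespace Summit.NavierStokesRegularity.NavierStokesRegularity.Cruxes.TypeIQuantSubcubicExp.SmoothSilence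

open MeasureTheory Set Function Filter Topology Metric
open scoped ENNReal NNReal Laplacian RealInnerProductSpace
open Literature.Analysis Literature.Analysis.FluidPDE
open Summit.NavierStokesRegularity.NavierStokesRegularity.Cruxes.TypeIQuantSubcubicExp.LimitSilence
  (preimage_affine_Icc setLIntegral_ball_comp_affine)

/-! ### The homothety bound for iterated derivatives of a rescaled slice -/

/-- `‖Dʲ[z ↦ c • ψ(y + σ z)](z)‖ ≤ |c| |σ|ʲ ‖Dʲψ(y + σ z)‖` (no differentiability hypothesis). -/
theorem norm_iteratedFDeriv_smul_comp_affine_le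
    (ψ : EuclideanSpace ℝ (Fin 3) → EuclideanSpace ℝ (Fin 3)) (c : ℝ) {σ : ℝ} (hσ : σ ≠ 0)
    (y : EuclideanSpace ℝ (Fin 3)) (j : ℕ) (z : EuclideanSpace ℝ (Fin 3)) :
    ‖iteratedFDeriv ℝ j (fun w => c • ψ (y + σ • w)) z‖ ≤ |c| * |σ| ^ j * ‖iteratedFDeriv ℝ j ψ (y + σ • z)‖ := by
  rw [iteratedFDeriv_const_smul_real (fun w => ψ (y + σ • w)) c j, norm_smul, Real.norm_eq_abs, mul_assoc]
  refine mul_le_mul_of_nonneg_left ?_ (abs_nonneg c)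
  have h := norm_iteratedFDeriv_comp_smul_le (fun w => ψ (y + w)) hσ j z
  rw [iteratedFDeriv_comp_add_left j y (σ • z)] at h
  exact h

/-! ### L♯1 -/

/-- **L♯1 — `stub_smoothNormalisation : SmoothNormalisation` (BY NAME).** -/
theorem stub_smoothNormalisation : SmoothNormalisation := by
  intro hneg
  unfold DriftStretchSilencingCost at hneg
  push Not at hneg
  obtain ⟨B, γ, δ, Γ₂, hB, hγ, hδ, hΓ₂, hbad⟩ := hneg
  refine ⟨B, γ, δ, Γ₂, hB, hγ, hδ, hΓ₂, fun n => ?_⟩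
  -- the bad configuration at aperture `Γ₂ + n` and floor `min δ (1/(n+1))`
  set K : ℝ := Γ₂ + n with hK
  set c : ℝ := min δ (1 / ((n : ℝ) + 1)) with hc
  have hn0 : (0 : ℝ) ≤ n := Nat.cast_nonneg n
  have hKΓ : Γ₂ ≤ K := by rw [hK]; linarith
  have hcpos : 0 < c := lt_min hδ (by positivity)
  have hcδ : c ≤ δ := min_le_left _ _
  obtain ⟨ω, v, y, σ, t, t₁, hσ, htt₁, ht₁, hbox, hinit, hfinal⟩ := hbad K c hKΓ hcpos hcδ
  obtain ⟨hsmω, hsmv, hbox⟩ := hbox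
  have hσ2 : 0 < σ ^ 2 := by positivity
  have hσ20 : σ ^ 2 ≠ 0 := hσ2.ne'
  have hσ0 : σ ≠ 0 := hσ.ne'
  -- the rescaled pair and its span
  set ωr : ℝ → EuclideanSpace ℝ (Fin 3) → EuclideanSpace ℝ (Fin 3) := σ ^ 2 • stPull (σ ^ 2) σ t y ω with hωr
  set vr : ℝ → EuclideanSpace ℝ (Fin 3) → EuclideanSpace ℝ (Fin 3) := σ • stPull (σ ^ 2) σ t y v with hvr
  set s₁ : ℝ := (t₁ - t) / σ ^ 2 with hs₁
  have hωr_apply : ∀ s z, ωr s z = σ ^ 2 • ω (t + σ ^ 2 * s) (y + σ • z) := fun s z => by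
    simp only [hωr, Pi.smul_apply, stPull_apply]
  have hvr_apply : ∀ s z, vr s z = σ • v (t + σ ^ 2 * s) (y + σ • z) := fun s z => by
    simp only [hvr, Pi.smul_apply, stPull_apply]
  have hωr_slice : ∀ s, ωr s = fun z => σ ^ 2 • ω (t + σ ^ 2 * s) (y + σ • z) := fun s => funext (hωr_apply s)
  have hvr_slice : ∀ s, vr s = fun z => σ • v (t + σ ^ 2 * s) (y + σ • z) := fun s => funext (hvr_apply s)
  have hpre : (fun r => t + σ ^ 2 * r) ⁻¹' Icc t t₁ = Icc 0 s₁ := preimage_affine_Icc hσ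
  have hs₁pos : 0 < s₁ := div_pos (by linarith) hσ2
  have hs₁le : s₁ ≤ 1 := by rw [hs₁, div_le_one hσ2]; linarith
  have hts₁ : t + σ ^ 2 * s₁ = t₁ := by rw [hs₁]; field_simp; ring
  -- dictionary: rescaled points lie in the original box
  have htime : ∀ {s : ℝ}, s ∈ Icc 0 s₁ → t + σ ^ 2 * s ∈ Icc t t₁ := fun {s} hs => by
    have : s ∈ (fun r => t + σ ^ 2 * r) ⁻¹' Icc t t₁ := by rw [hpre]; exact hs
    exact this
  have hspace : ∀ {z : EuclideanSpace ℝ (Fin 3)}, z ∈ ball (0 : EuclideanSpace ℝ (Fin 3)) (2 * (Γ₂ + n)) →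
      y + σ • z ∈ ball y (2 * K * σ) := fun {z} hz => by
    rw [mem_ball, dist_zero_right] at hz
    rw [mem_ball, dist_eq_norm, add_sub_cancel_left, norm_smul, Real.norm_of_nonneg hσ.le, hK]
    nlinarith
  -- powers of `σ` as reciprocals
  have hrpow : ∀ m : ℕ, σ ^ (-((m : ℝ))) = (σ ^ m)⁻¹ := fun m => by
    rw [Real.rpow_neg hσ.le, Real.rpow_natCast]
  have hone : ∀ e : ℝ, (1 : ℝ) ^ e = 1 := fun e => Real.one_rpow e
  -- smoothness of the rescaled pair
  have hsmωr : IsSmoothSpaceTimeOn (Icc 0 s₁) ωr := by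
    have h := hsmω.smul_stPull (σ ^ 2) (σ ^ 2) σ t y
    rw [hpre] at h
    exact h
  have hsmvr : IsSmoothSpaceTimeOn (Icc 0 s₁) vr := by
    have h := hsmv.smul_stPull σ (σ ^ 2) σ t y
    rw [hpre] at h
    exact h
  -- the `L²` masses
  have hconst : ENNReal.ofReal (σ ^ 2) ^ 2 * ENNReal.ofReal (σ ^ 3)⁻¹ = ENNReal.ofReal σ := by
    rw [← ENNReal.ofReal_pow hσ2.le, ← ENNReal.ofReal_mul (by positivity)]
    congr 1
    rw [← div_eq_mul_inv, div_eq_iff (by positivity)]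
    ring
  have hmass : ∀ s R, ∫⁻ z in ball (0 : EuclideanSpace ℝ (Fin 3)) R, ‖ωr s z‖ₑ ^ 2 =
      ENNReal.ofReal σ * ∫⁻ x in ball y (σ * R), ‖ω (t + σ ^ 2 * s) x‖ₑ ^ 2 := fun s R => by
    have h1 : ∀ z, ‖ωr s z‖ₑ ^ 2 =
        ENNReal.ofReal (σ ^ 2) ^ 2 * ‖ω (t + σ ^ 2 * s) (y + σ • z)‖ₑ ^ 2 := fun z => by
      rw [hωr_apply, enorm_smul, Real.enorm_eq_ofReal hσ2.le, mul_pow]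
    simp_rw [h1]
    rw [lintegral_const_mul' _ _ (ENNReal.pow_ne_top ENNReal.ofReal_ne_top),
      setLIntegral_ball_comp_affine hσ y R (fun x => ‖ω (t + σ ^ 2 * s) x‖ₑ ^ 2), ← mul_assoc, hconst]
  have hσE : ENNReal.ofReal σ ≠ 0 := (ENNReal.ofReal_pos.2 hσ).ne'
  refine ⟨ωr, vr, s₁, hs₁pos, hs₁le, ⟨hsmωr, hsmvr, ?_⟩, ?_, ?_⟩
  · -- the box clauses at scale `1`
    intro s hs z hz
    have hs' := htime hs
    have hx' := hspace hz
    obtain ⟨hωb, hvb, hmod, heqn⟩ := hbox (t + σ ^ 2 * s) hs' (y + σ • z) hx'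
    refine ⟨?_, ?_, ?_, ?_⟩
    · -- `‖Dʲ ω̃‖ ≤ σ² σʲ ‖Dʲ ω‖ ≤ σ^{j+2} B σ^{-(j+2)} = B`
      intro j hj
      have h := hωb j hj
      rw [show (-((j : ℝ) + 2)) = -(((j + 2 : ℕ) : ℝ)) by push_cast; ring, hrpow] at h
      rw [hone, mul_one, hωr_slice]
      calc ‖iteratedFDeriv ℝ j (fun w => σ ^ 2 • ω (t + σ ^ 2 * s) (y + σ • w)) z‖
          ≤ |σ ^ 2| * |σ| ^ j * ‖iteratedFDeriv ℝ j (ω (t + σ ^ 2 * s)) (y + σ • z)‖ :=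
            norm_iteratedFDeriv_smul_comp_affine_le _ _ hσ0 y j z
        _ ≤ |σ ^ 2| * |σ| ^ j * (B * (σ ^ (j + 2))⁻¹) :=
            mul_le_mul_of_nonneg_left h (by positivity)
        _ = B := by
            rw [abs_of_pos hσ2, abs_of_pos hσ]
            field_simp
            try ring
    · -- `‖Dʲ ṽ‖ ≤ σ σʲ ‖Dʲ v‖ ≤ σ^{j+1} B σ^{-(j+1)} = B`
      intro j hj
      have h := hvb j hj
      rw [show (-((j : ℝ) + 1)) = -(((j + 1 : ℕ) : ℝ)) by push_cast; ring, hrpow] at h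
      rw [hone, mul_one, hvr_slice]
      calc ‖iteratedFDeriv ℝ j (fun w => σ • v (t + σ ^ 2 * s) (y + σ • w)) z‖
          ≤ |σ| * |σ| ^ j * ‖iteratedFDeriv ℝ j (v (t + σ ^ 2 * s)) (y + σ • z)‖ :=
            norm_iteratedFDeriv_smul_comp_affine_le _ _ hσ0 y j z
        _ ≤ |σ| * |σ| ^ j * (B * (σ ^ (j + 1))⁻¹) :=
            mul_le_mul_of_nonneg_left h (by positivity)
        _ = B := by
            rw [abs_of_pos hσ]
            field_simp
            try ring
    · -- the time moduli are scale-invariant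
      intro s' hs''
      have hs''' := htime hs''
      obtain ⟨m0, m1, m2⟩ := hmod (t + σ ^ 2 * s') hs'''
      have hratio : |t + σ ^ 2 * s - (t + σ ^ 2 * s')| / σ ^ 2 = |s - s'| := by
        rw [show t + σ ^ 2 * s - (t + σ ^ 2 * s') = σ ^ 2 * (s - s') by ring, abs_mul, abs_of_pos hσ2,
          mul_div_cancel_left₀ _ hσ20]
      have hratio1 : |s - s'| / (1 : ℝ) ^ 2 = |s - s'| := by rw [one_pow, div_one]
      rw [hratio] at m0 m1 m2
      simp only [hratio1, hone, mul_one]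
      have hfac : 0 ≤ |s - s'| ^ γ := Real.rpow_nonneg (abs_nonneg _) _
      have hm0 : σ ^ (-(1 : ℝ)) = σ⁻¹ := Real.rpow_neg_one σ
      have hm2' : σ ^ (-(2 : ℝ)) = (σ ^ 2)⁻¹ := by rw [Real.rpow_neg hσ.le, Real.rpow_two]
      have hm3' : σ ^ (-(3 : ℝ)) = (σ ^ 3)⁻¹ := by simpa using hrpow 3
      rw [hm0] at m0
      rw [hm2'] at m1
      rw [hm3'] at m2
      refine ⟨?_, ?_, ?_⟩
      · -- order 0
        rw [hvr_apply, hvr_apply, ← smul_sub, norm_smul, Real.norm_of_nonneg hσ.le]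
        calc σ * ‖v (t + σ ^ 2 * s) (y + σ • z) - v (t + σ ^ 2 * s') (y + σ • z)‖
            ≤ σ * (B * σ⁻¹ * |s - s'| ^ γ) := mul_le_mul_of_nonneg_left m0 hσ.le
          _ = B * |s - s'| ^ γ := by field_simp
      · -- order 1
        have hd : ∀ r ∈ Icc 0 s₁, fderiv ℝ (vr r) z = (σ * σ) • fderiv ℝ (v (t + σ ^ 2 * r)) (y + σ • z) := by
          intro r hr
          have hdiff : Differentiable ℝ (stPull (σ ^ 2) σ t y v r) :=
            differentiable_stPull_slice ((hsmv.contDiff_slice (htime hr)).differentiable (by simp))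
          rw [show vr r = σ • stPull (σ ^ 2) σ t y v r from rfl, fderiv_const_smul (hdiff z), fderiv_stPull,
            smul_smul]
        rw [hd s hs, hd s' hs'',
          show (σ * σ) • fderiv ℝ (v (t + σ ^ 2 * s)) (y + σ • z) - (σ * σ) • fderiv ℝ (v (t + σ ^ 2 * s')) (y + σ • z) =
              (σ * σ) • (fderiv ℝ (v (t + σ ^ 2 * s)) (y + σ • z) - fderiv ℝ (v (t + σ ^ 2 * s')) (y + σ • z))
            from (smul_sub _ _ _).symm, norm_smul, Real.norm_of_nonneg (by positivity)]
        calc σ * σ * ‖fderiv ℝ (v (t + σ ^ 2 * s)) (y + σ • z) - fderiv ℝ (v (t + σ ^ 2 * s')) (y + σ • z)‖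
            ≤ σ * σ * (B * (σ ^ 2)⁻¹ * |s - s'| ^ γ) := mul_le_mul_of_nonneg_left m1 (by positivity)
          _ = B * |s - s'| ^ γ := by field_simp
      · -- order 2: the difference of the rescaled slices is the rescaled difference
        have hc2 : ∀ r ∈ Icc 0 s₁, ContDiff ℝ 2 (v (t + σ ^ 2 * r)) := fun r hr =>
          (hsmv.contDiff_slice (htime hr)).of_le (by norm_cast)
        have hc2r : ∀ r ∈ Icc 0 s₁, ContDiff ℝ 2 (vr r) := fun r hr =>
          (hsmvr.contDiff_slice hr).of_le (by norm_cast)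
        have hsub : iteratedFDeriv ℝ 2 (vr s) z - iteratedFDeriv ℝ 2 (vr s') z =
            iteratedFDeriv ℝ 2 (fun w => σ • (v (t + σ ^ 2 * s) - v (t + σ ^ 2 * s')) (y + σ • w)) z := by
          rw [← iteratedFDeriv_sub_apply ((hc2r s hs).contDiffAt) ((hc2r s' hs'').contDiffAt)]
          congr 1
          funext w
          simp only [Pi.sub_apply, hvr_apply, smul_sub]
        have hsub' : iteratedFDeriv ℝ 2 (v (t + σ ^ 2 * s) - v (t + σ ^ 2 * s')) (y + σ • z) =
            iteratedFDeriv ℝ 2 (v (t + σ ^ 2 * s)) (y + σ • z) -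
              iteratedFDeriv ℝ 2 (v (t + σ ^ 2 * s')) (y + σ • z) :=
          iteratedFDeriv_sub_apply ((hc2 s hs).contDiffAt) ((hc2 s' hs'').contDiffAt)
        rw [hsub]
        calc ‖iteratedFDeriv ℝ 2 (fun w => σ • (v (t + σ ^ 2 * s) - v (t + σ ^ 2 * s')) (y + σ • w)) z‖
            ≤ |σ| * |σ| ^ 2 * ‖iteratedFDeriv ℝ 2 (v (t + σ ^ 2 * s) - v (t + σ ^ 2 * s')) (y + σ • z)‖ :=
              norm_iteratedFDeriv_smul_comp_affine_le _ _ hσ0 y 2 z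
          _ ≤ |σ| * |σ| ^ 2 * (B * (σ ^ 3)⁻¹ * |s - s'| ^ γ) := by
              rw [hsub']
              exact mul_le_mul_of_nonneg_left m2 (by positivity)
          _ = B * |s - s'| ^ γ := by
              rw [abs_of_pos hσ]
              field_simp
    · -- the equation scales by `σ⁴`
      have hω2 : ContDiff ℝ 2 (ω (t + σ ^ 2 * s)) := (hsmω.contDiff_slice hs').of_le (by norm_cast)
      have hω2' : ContDiffAt ℝ 2 (stPull (σ ^ 2) σ t y ω s) z := (contDiff_stPull_slice hω2).contDiffAt
      have hdiffω : Differentiable ℝ (stPull (σ ^ 2) σ t y ω s) :=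
        differentiable_stPull_slice (hω2.differentiable (by norm_num))
      have hdiffv : Differentiable ℝ (stPull (σ ^ 2) σ t y v s) :=
        differentiable_stPull_slice ((hsmv.contDiff_slice hs').differentiable (by simp))
      have htd : timeDerivWithin (Icc 0 s₁) ωr s z =
          (σ ^ 2 * σ ^ 2) • timeDerivWithin (Icc t t₁) ω (t + σ ^ 2 * s) (y + σ • z) := by
        rw [← hpre, hωr]
        exact timeDerivWithin_smul_stPull (Icc t t₁) ω (σ ^ 2) hσ20 σ t y s z
      have hlap : (Δ (ωr s)) z = (σ ^ 2 * σ ^ 2) • (Δ (ω (t + σ ^ 2 * s))) (y + σ • z) := by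
        rw [show ωr s = σ ^ 2 • stPull (σ ^ 2) σ t y ω s from rfl, InnerProductSpace.laplacian_smul _ hω2',
          laplacian_stPull (σ ^ 2) σ t y ω s z hω2, smul_smul]
      have hDv : fderiv ℝ (vr s) z = (σ * σ) • fderiv ℝ (v (t + σ ^ 2 * s)) (y + σ • z) := by
        rw [show vr s = σ • stPull (σ ^ 2) σ t y v s from rfl, fderiv_const_smul (hdiffv z), fderiv_stPull,
          smul_smul]
      have hDω : fderiv ℝ (ωr s) z = (σ ^ 2 * σ) • fderiv ℝ (ω (t + σ ^ 2 * s)) (y + σ • z) := by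
        rw [show ωr s = σ ^ 2 • stPull (σ ^ 2) σ t y ω s from rfl, fderiv_const_smul (hdiffω z), fderiv_stPull,
          smul_smul]
      rw [htd, hlap, hDv, hDω, hωr_apply, hvr_apply, heqn]
      simp only [FunLike.coe_smul, Pi.smul_apply, map_smul, smul_smul, smul_add, smul_sub]
      congr 1 <;> [congr 1; skip] <;> ring_nf
  · -- initial mass `≥ δ` on `B(0, Γ₂)`
    rw [hmass 0 Γ₂, mul_zero, add_zero, mul_comm σ Γ₂]
    calc ENNReal.ofReal δ = ENNReal.ofReal σ * ENNReal.ofReal (δ / σ) := by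
          rw [← ENNReal.ofReal_mul hσ.le]
          congr 1
          field_simp
      _ ≤ ENNReal.ofReal σ * ∫⁻ x in ball y (Γ₂ * σ), ‖ω t x‖ₑ ^ 2 := by gcongr
  · -- final mass `< 1/(n+1)` on `B(0, Γ₂ + n)`
    rw [hmass s₁ (Γ₂ + n), hts₁, mul_comm σ (Γ₂ + n), ← hK]
    calc ENNReal.ofReal σ * ∫⁻ x in ball y (K * σ), ‖ω t₁ x‖ₑ ^ 2
        < ENNReal.ofReal σ * ENNReal.ofReal (c / σ) :=
          ENNReal.mul_lt_mul_right hσE ENNReal.ofReal_ne_top hfinal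
      _ = ENNReal.ofReal c := by
          rw [← ENNReal.ofReal_mul hσ.le]
          congr 1
          field_simp
      _ ≤ ENNReal.ofReal (1 / ((n : ℝ) + 1)) := ENNReal.ofReal_le_ofReal (min_le_right _ _)

end Summit.NavierStokesRegularity.NavierStokesRegularity.Cruxes.TypeIQuantSubcubicExp.SmoothSilence

end
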